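import Mathlib.AlgebraicGeometry.AffineScheme
import Literature.AlgebraicGeometry.Resolution.WeightedResolutionDatum
import Summits.ResolutionOfSingularities.ResolutionOfSingularities.Theorems.WeightedInvariantWeightedConstructionWeightedChartBasicOpen

/-!
# A weighted chart restricts to a weighted chart on an affine sub-open

Route `ResolutionOfSingularities/WeightedInvariant`, crux `WeightedConstruction`
(stmt-ResolutionOfSingularities-0571), line `support-first-weights-second`, stub
`stub_isWeightedChart_of_le`.

Let `R` be a Rees algebra on a scheme `Y` (`ReesAlgebraData`, `WeightedResolutionDatum.lean`) and
`(U, u, w)` a weighted chart of `R` (`ReesAlgebraData.IsWeightedChart`: positive weights, the pieces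
`Rₙ(U)` are the weighted monomial ideals `(u^α : Σ wᵢ αᵢ ≥ n)`, and at every point `y ∈ U` where
all `uᵢ` vanish their classes in `𝔪_y / 𝔪_y²` are linearly independent). For an affine sub-open
`V ≤ U`, the restrictions `uᵢ|_V` with the same weights form a weighted chart of `R` on `V`:

* the weights are unchanged, hence positive;
* `Rₙ(V) = Rₙ(U) · Γ(Y, V)` (`Scheme.IdealSheafData.map_ideal'`) is the weighted monomial ideal of
  the restrictions `uᵢ|_V` (`weightedMonomialIdeal_map`: the image of a monomial is a monomial);
* at a point `y ∈ V` the germ of `uᵢ|_V` is the germ of `uᵢ` (`TopCat.Presheaf.germ_res_apply`),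
  so the cotangent classes are literally those of the chart on `U`, linearly independent by
  hypothesis.
-/

noncomputable section

set_option linter.dupNamespace false -- mandated namespace of this single-conjunct summit

namespace Summit.ResolutionOfSingularities.ResolutionOfSingularities.Theorems

open CategoryTheory AlgebraicGeometry TopologicalSpace Literature.AlgebraicGeometry.Resolution
open scoped LaurentPolynomial

/-- **A weighted chart restricts to affine sub-opens.** If `(U, u, w)` is a weighted chart of the
Rees algebra `R` on `Y` and `V ≤ U` is an affine open, then `(V, u|_V, w)` is a weighted chart of
`R`: the pieces restrict (`Rₙ(V) = Rₙ(U) · Γ(Y, V)` is the weighted monomial ideal of the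
restricted parameters) and the germs of the restricted parameters at a point of `V` are the germs
of the parameters, so the cotangent condition is inherited verbatim. [folklore] -/
theorem stub_isWeightedChart_of_le :
    ∀ ⦃Y : Scheme.{0}⦄ (R : ReesAlgebraData Y) (U : Y.affineOpens) {m : ℕ} (u : Fin m → Γ(Y, U))
      (w : Fin m → ℕ), R.IsWeightedChart U u w → ∀ (V : Y.affineOpens) (hVU : (V : Y.Opens) ≤ U),
      R.IsWeightedChart V (fun i => (Y.presheaf.map (homOfLE hVU).op).hom (u i)) w := by
  intro Y R U m u w hchart V hVU
  refine ⟨hchart.w_pos, fun n => ?_, fun y hyV hgerm => ?_⟩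
  · -- the pieces over `V` are the restricted pieces over `U`
    rw [← (R.piece n).map_ideal' (U := V) (V := U) (homOfLE hVU).op, hchart.ideal_eq n,
      weightedMonomialIdeal_map]
  · -- `germ_V (uᵢ|_V) = germ_U uᵢ`
    have hgermres : ∀ i, (Y.presheaf.germ (V : Y.Opens) y hyV).hom
        ((Y.presheaf.map (homOfLE hVU).op).hom (u i)) =
        (Y.presheaf.germ (U : Y.Opens) y (hVU hyV)).hom (u i) := fun i =>
      TopCat.Presheaf.germ_res_apply Y.presheaf (homOfLE hVU) y hyV (u i)
    have hgermU : ∀ i, (Y.presheaf.germ (U : Y.Opens) y (hVU hyV)).hom (u i) ∈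
        IsLocalRing.maximalIdeal (Y.presheaf.stalk y) := fun i =>
      hgermres i ▸ hgerm i
    have hli := hchart.linearIndependent y (hVU hyV) hgermU
    have hfun : (fun i => (IsLocalRing.maximalIdeal (Y.presheaf.stalk y)).toCotangent
        ⟨(Y.presheaf.germ (V : Y.Opens) y hyV).hom
          ((Y.presheaf.map (homOfLE hVU).op).hom (u i)), hgerm i⟩) =
        (fun i => (IsLocalRing.maximalIdeal (Y.presheaf.stalk y)).toCotangent
          ⟨(Y.presheaf.germ (U : Y.Opens) y (hVU hyV)).hom (u i), hgermU i⟩) := by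
      funext i
      congr 1
      exact Subtype.ext (hgermres i)
    rw [hfun]
    exact hli

end Summit.ResolutionOfSingularities.ResolutionOfSingularities.Theorems

end
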